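import Literature.NumberTheory.EllipticCurves.KellerYin2024.AnomalousImprimitiveLambdaInvariants
import Summits.BirchSwinnertonDyer.BirchSwinnertonDyer.Theorems.EisensteinPrimesUnrSelmerImprimitiveFiniteness
import HarnessLib

/-!
# Route `EisensteinPrimes` (rung K5), crux 2 `GoodLatticeBDPValue`, line `halves`: the first clause of
# KY/CGLS Prop. 1.2.5 ("`𝔛_θ^S` f.g., `Λ`-torsion, `μ = 0`") is a KERNEL consequence of its quotient form

Cell `bsd-eis` (home `run/shared/lean/pub/bsd-eis/`), seat `bsd-eis-k5-c2` g11, OPTION (B0), third pass.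
The typed [PWL-θ] input of the line comes in two strengths (both in
`Literature/…/KellerYin2024/AnomalousImprimitiveLambdaInvariants.lean`): the STRONG form
`prop125_residualPair_unrSelmer_imprimitive` (§3: "every dual datum of `H¹_{𝓕_nr^{Sf}}` is f.g.
torsion `μ = 0` AND `corank_{ℤ_p}(H¹_{𝓕_nr^{Sf}}/H¹_{𝓕_nr}) = Σ λ𝒫_w(θ)`", given [RH]) and the
QUOTIENT form `prop125_residualPair_unrSelmer_quotient` (§5: "`(H¹_{𝓕_nr^{Sf}}/H¹_{𝓕_nr})[p]` is finite
AND the corank identity", given [RH]) — the latter is exactly what Pollack–Weston A.2 ∘ Lemma 1.1.1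
say about the quotient `≅ ∏_{w∈S} H¹(K_w, M_θ)`. This file proves STRONG ⇐ QUOTIENT in the kernel:
Greenberg–Vatsal Cor. (2.3) for a generic module
(`UnrSelmerImprimitiveFiniteness.moduleFinite_isTorsion_mu_lambda_of_primitive`, p569470) turns
"[RH] for the primitive dual + `Q[p]` finite" into "the imprimitive dual is f.g. torsion with the same
`μ`". So the skeleton `halves` v13 registers the quotient form as its [PWL-θ] stub and derives the
strong form. Route-independent module (no `Theses` import).

HONEST FRAMING: a theorem between two named statements; nothing booked; BSD is proved for no curve.
-/

set_option linter.dupNamespace false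
set_option autoImplicit false

noncomputable section

open scoped Classical

open WeierstrassCurve NumberField IsDedekindDomain Field
  Literature.NumberTheory.EllipticCurves Literature.NumberTheory.EllipticCurves.ModularForms
  Literature.NumberTheory.QuadraticFields Literature.NumberTheory.EllipticCurves.Rank1Residual
  Literature.NumberTheory.EllipticCurves.Castella2018 Literature.NumberTheory.EllipticCurves.GreenbergSelmer
  Literature.NumberTheory.EllipticCurves.GreenbergVatsal2000 Literature.NumberTheory.GaloisRepresentations
  Literature.NumberTheory.EllipticCurves.CastellaGrossiLeeSkinner2022
  Literature.NumberTheory.EllipticCurves.KellerYin2024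
open Summit.BirchSwinnertonDyer.BirchSwinnertonDyer.Theorems

namespace Summit.BirchSwinnertonDyer.BirchSwinnertonDyer.Theorems.GoodLatticeImprimitiveOfQuotient

/-- **[PWL-θ] STRONG ⇐ [PWL-θ] QUOTIENT**: `prop125_residualPair_unrSelmer_quotient` implies
`prop125_residualPair_unrSelmer_imprimitive`. Given [RH] for the character `θ` (every dual datum of
`H¹_{𝓕_nr}` f.g. torsion `μ = 0`) the quotient form yields `Q[p]` finite and the corank identity; a
primitive dual datum exists (`nonempty_unrDualData_char`), and Greenberg–Vatsal Cor. (2.3) for the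
generic character module (`moduleFinite_isTorsion_mu_lambda_of_primitive`, p569470) gives, for EVERY
imprimitive dual datum `DS`: f.g., `Λ`-torsion, `μ(DS) = μ(D) = 0`. The first clause of KY/CGLS
Prop. 1.2.5 is thus kernel, not typed. [cite: KellerYin2024, Prop. 1.2.5 and proof (arXiv:2402.12781v2 TeX L780–800)]
[cite: CastellaGrossiLeeSkinner2022, Prop. 1.2.5 and proof (arXiv:2008.02571v2 TeX L681–703)]
[cite: GreenbergVatsal2000, §2 Cor. (2.3) (pp. 20–21)] -/
theorem prop125_imprimitive_of_quotient (h : prop125_residualPair_unrSelmer_quotient) :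
    prop125_residualPair_unrSelmer_imprimitive := by
  intro W _ _ p _ hp hgood hred hanom hlat K _ _ hK hH hHp htor ι v vbar hv hvbar hne κ hκ γ _ θsub θquot
    hpair Sf hSf θ hθ hRH
  have hγ : κ.IsTopGenerator γ := Fact.out
  obtain ⟨hQ, hcork⟩ := h W p hp hgood hred hanom hlat K hK hH hHp htor ι v vbar hv hvbar hne κ hκ γ θsub
    θquot hpair Sf hSf θ hθ hRH
  refine ⟨fun DS ↦ ?_, hcork⟩
  obtain ⟨D⟩ := nonempty_unrDualData_char (∅ : Set (PadicAlgCl p)) θ κ vbar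
    (∅ : Set (HeightOneSpectrum (𝓞 K))) hγ
  obtain ⟨hfg, htors, hμ⟩ := hRH D
  haveI := hfg
  obtain ⟨hfgS, htorsS, hμS, -⟩ :=
    UnrSelmerImprimitiveFiniteness.moduleFinite_isTorsion_mu_lambda_of_primitive κ vbar
      (exists_pow_smul_cofree_eq_zero (∅ : Set (PadicAlgCl p)) θ)
      (isOpen_stabilizer_cofree (∅ : Set (PadicAlgCl p)) θ) hγ
      (Set.empty_subset (↑Sf : Set (HeightOneSpectrum (𝓞 K)))) D htors DS hQ
  exact ⟨hfgS, htorsS, hμS.trans hμ⟩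

end Summit.BirchSwinnertonDyer.BirchSwinnertonDyer.Theorems.GoodLatticeImprimitiveOfQuotient

end
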